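import Literature.Analysis.FluidPDE.Vorticity
import Literature.Analysis.FluidPDE.LerayHopf
import Literature.Analysis.FluidPDE.LocalTypeI
import HarnessLib

/-!
# Vorticity alignment on concentrating balls versus Type I blow-up, whole space
# (Barker–Prange 2020, Theorem 3 and Remark 15)

Topic `Analysis/FluidPDE`. Source: T. Barker, C. Prange, *Scale-invariant estimates and vorticity
alignment for Navier–Stokes in the half-space with no-slip boundary conditions*, Arch. Ration.
Mech. Anal. **235** (2020) 881–926 = arXiv:1906.08225 [BarkerPrange2020Alignment] (held, lit key
`paper:arxiv-1906.08225`; read in the arXiv version: §1 p. 3 (definition of regular / singular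
points, Theorem 1 = the half-space main theorem), §5.2 p. 18 (**Theorem 3** and **Remark 15**, the
WHOLE-SPACE improvement), §6 p. 19 (Theorem 4, the localised half-space version)). The half-space
statements (Theorems 1, 2, 4) need no-slip / half-space mild-solution vocabulary the tree does not
have and are NOT vendored here; Theorem 3 lives on `ℝ³` and is stated in the frame of the tree's
other Type-I direction criterion `gigaMiura_continuousAlignment_typeI` (`ContinuousAlignmentTypeI.lean`,
Giga–Miura 2011), which it refines ("this improves the result obtained in [GM11]", p. 18).

No regularity or blow-up claim about Navier–Stokes is made by this file beyond the printed
theorem, recorded as a named fact (`def … : Prop`, cite-tagged, unproved here) together with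
proved consequences `theorem … (h : <fact>) : …`.

## What is printed (arXiv:1906.08225, p. 3 and p. 18, verbatim up to notation)

P. 3: "we say that `(x₀, T)` is a 'regular point' of `u` if there exists `r > 0` such that
`u ∈ L^∞((B(x₀, r) ∩ ℝ³₊) × (T − r², T))`. Any point that is not regular is defined to be a
'singular point'."

**Theorem 3** (§5.2, p. 18). "Suppose `u` is a mild solution to the Navier–Stokes equations in
`ℝ³ × (0, T)` with divergence-free initial data `u₀ ∈ C₀^∞(ℝ³)`. Furthermore, suppose that for
`(x, t) ∈ ℝ³ × (0, T)`: `|u(x, t)| ≤ M/√(T − t)`. Let `t⁽ⁿ⁾ ↑ T`, `x₀ ∈ ℝ³`, `d > 0` and `δ > 0`.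
Define `ω = ∇ × u`, `ξ := ω/|ω|`, `Ω_d := {(x, t) ∈ ℝ³ × (0, T) : |ω(x, t)| > d}` and
`𝒞_{t⁽ⁿ⁾, δ, x₀} := ⋃ₙ {(x, t⁽ⁿ⁾) : |x − x₀| < δ√(T − t⁽ⁿ⁾)}`. Let `η : ℝ → ℝ` be a continuous
function with `η(0) = 0`. Under the above assumptions, there exists `δ(M, u₀) > 0` such that the
following holds true:
`sup_{(x,t) ∈ 𝒞_{t⁽ⁿ⁾,δ,x₀}} |ω(x, t)| < ∞ ⇒ (x₀, T)` is a regular point of `u`,           (5.3)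
`|ξ(x, t) − ξ(y, t)| ≤ Cη(|x − y|)` in `Ω_d ∩ 𝒞_{t⁽ⁿ⁾,δ,x₀}` `⇒ (x₀, T)` is a regular point of
`u`.                                                                                     (5.4)
The proof is essentially the same to that of Theorem 1, hence we omit it. The difference is that
one takes `R⁽ⁿ⁾ := √(T − t⁽ⁿ⁾)` and then rescales …"

**Remark 15** (p. 18). "Consider `u, ξ, u₀, T` and `t⁽ⁿ⁾` be as in the above theorem, but assume
that `u` first loses smoothness at time `T`. Let `η` be any fixed modulus of continuity with
`η(0) = 0`. The result in [GM11] implies that `ξ` breaks the modulus of continuity `η` on the set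
`Ω_d ∩ (ℝ³ × (0, t⁽ⁿ⁾))` for all `n` sufficiently large. Since a finite blow-up time `T` implies
the existence of a singular point `x₀`, our Theorem above implies a more precise description of
the vorticity direction near the blow-up time. Namely, the modulus of continuity `η` is broken on
the set `{(x, t⁽ⁿ⁾) : |x − x₀| < δ√(T − t⁽ⁿ⁾)} ∩ Ω_d` for all sufficiently large `n`."

## Transcription into the tree's vocabulary (as in `ContinuousAlignmentTypeI.lean`)

* Physical space `EuclideanSpace ℝ (Fin 3)`, time first (`u : ℝ → ℝ³ → ℝ³`); viscosity `ν > 0`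
  (printed `ν = 1`; the Navier–Stokes scaling `v(x, s) = ν⁻¹ u(x, s/ν)`, `q = ν⁻² p(x, s/ν)`
  turns a viscosity-`ν` solution on `(0, T)` into a viscosity-`1` solution on `(0, νT)` with
  Type-I constant `M/√ν`, vorticity threshold `d/ν`, the same direction field `ξ`, and the
  parabolic balls `|x − x₀| < δ√(ν(T − t))`; since `δ` is existentially quantified after `ν`,
  `M` and the solution, and `d` is arbitrary, the transcription is exact).
* "mild solution in `ℝ³ × (0, T)` with divergence-free initial data `u₀ ∈ C₀^∞`": a classical
  unforced solution `(u, p)` on `ℝ³ × [0, T)` (`IsClassicalNSSolutionOn (Ico 0 T) ν 0 u p`, which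
  contains `div u(t) = 0` and the smoothness of `u 0`) that is Leray–Hopf on `[0, T)` from its
  datum (`IsLerayHopfOn T ν 0 (u 0) u` — finite energy excludes the parasitic solutions
  `u = b(t)`, so that the bounded classical solution is the mild solution of the printed class,
  the same recording step as in `gigaMiura_continuousAlignment_typeI`) with `HasCompactSupport (u 0)`.
* The Type-I bound is recorded verbatim and globally on `(0, T)` with its constant `M`:
  `‖u t x‖ ≤ M/√(T − t)` (stronger than the tree's eventual-form `IsTypeIBlowup u T`; the printed
  `δ = δ(M, u₀)` depends on this `M`).
* "`(x₀, T)` is a regular point" (p. 3, whole space: `u ∈ L^∞(B(x₀, r) × (T − r², T))` for some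
  `r > 0`) is EXACTLY the negation of the tree's backward singular point
  `IsBackwardSingularPoint u (T, x₀)` (`LocalTypeI.lean`, Albritton–Barker 2019: `u ∉ L^∞(Q((T,x₀), r))`
  for every `r > 0`, backward cylinders `Q = (T − r², T) × B_r(x₀)` = `parabolicCylinder`); cf.
  `not_isBackwardSingularPoint_iff` (`VorticityDoubleConeRegularity.lean`). The centred notion
  `IsRegularPoint` is not used: `u` is only given before `T`.
* `t⁽ⁿ⁾ ↑ T`: a sequence `s : ℕ → ℝ` with `s n ∈ (0, T)`, strictly increasing, `s n → T`.
* `ω = curl (u t)`, `ξ = vorticityDirection (curl (u t))` (`= ‖ω‖⁻¹ • ω`, the printed `ξ` on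
  `{|ω| > d}`, `d > 0`). The hypothesis of (5.4) — the modulus `η` between any two points of the
  SAME slice `{t⁽ⁿ⁾} × B(x₀, δ√(T − t⁽ⁿ⁾))` at which `|ω| > d` — is the predicate
  `BarkerPrange2020.SliceAligned` below, required for every `n`; the printed unspecified constant
  `C` in `Cη` is absorbed into the arbitrary modulus `η` (we require the case `C = 1`, which is
  weaker to assume than any reading of the printed line and equivalent to it).
* The two implications (5.3), (5.4) share the printed `δ(M, u₀)`: ONE existential `δ` serves both
  conjuncts of the fact.

## Contents

* `BarkerPrange2020.SliceAligned` — the slice hypothesis of (5.4) (definition, with unfolding lemma).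
* `barkerPrange2020_alignment_concentrating_typeI` — **Theorem 3** as a named fact.
* Proved consequences `(h : barkerPrange2020_alignment_concentrating_typeI)`:
  `….regular_of_frequently` (the hypothesis of (5.4) at a set of times accumulating at `T`, i.e.
  `∃ᶠ t in 𝓝[<] T`, suffices — sequence extraction); `….eventually_not_sliceAligned`
  (**Remark 15**: at a singular point `(T, x₀)` every modulus `η` is broken on
  `Ω_d ∩ {t⁽ⁿ⁾} × B(x₀, δ√(ν(T − t⁽ⁿ⁾)))` for all `n` large, along every sequence `t⁽ⁿ⁾ ↑ T`);
  `….regular_of_continuousAlignment` (Giga–Miura's global hypothesis (CA) on `Ω_d`, all times,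
  implies Barker–Prange's on every concentrating family, hence no singular point at time `T`:
  the sense in which Theorem 3 "improves [GM11]").

Mathlib / tree search (2026-08-26): `lean search 'BarkerPrange2020_thm3|vorticityAlignment|1906.08225'`
— the paper is cited in `BarkerPrangeConcentration*.lean` docstrings (a different paper,
arXiv:1812.09115, shares the authors and year) and in two Summits sketches; no decl states
Theorem 3. The frame (`IsClassicalNSSolutionOn`, `IsLerayHopfOn`, `IsBackwardSingularPoint`,
`vorticityDirection`, `parabolicCylinder`) is the tree's; Mathlib has no Navier–Stokes notions.

## References

* T. Barker, C. Prange, Arch. Ration. Mech. Anal. 235 (2020) 881–926,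
  doi:10.1007/s00205-019-01435-z = arXiv:1906.08225: p. 3 (regular points), §5.2 Theorem 3 and
  Remark 15 (p. 18). [BarkerPrange2020Alignment]
* Y. Giga, H. Miura, Comm. Math. Phys. 303 (2011) 289–300 (the result improved upon; tree fact
  `gigaMiura_continuousAlignment_typeI`). [GigaMiura2011]
* D. Albritton, T. Barker, J. Math. Fluid Mech. 21 (2019), §1 (backward singular points; tree
  `IsBackwardSingularPoint`). [AlbrittonBarker2019]
-/

noncomputable section

open MeasureTheory Set Function Filter Metric
open scoped Topology

namespace Literature.Analysis.FluidPDE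

namespace BarkerPrange2020

/-- **Barker–Prange's slice alignment hypothesis** (the premise of (5.4) in Theorem 3 of
Barker–Prange 2020 on ONE time slice `t`): the vorticity direction `ξ = ω/|ω|`, `ω = curl u(t,·)`,
admits the modulus `η` between any two points of the parabolic ball `B(x₀, δ√(ν(T − t)))` at
which `|ω| > d`: `‖ξ(x,t) − ξ(y,t)‖ ≤ η(‖x − y‖)`. Printed with `ν = 1` on the slices `t = t⁽ⁿ⁾`
of the "time-sliced cone" `𝒞_{t⁽ⁿ⁾,δ,x₀}` intersected with `Ω_d = {|ω| > d}`.
[cite: BarkerPrange2020Alignment, Thm. 3 (5.4) (arXiv:1906.08225, p. 18)] -/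
def SliceAligned (ν T : ℝ) (u : ℝ → EuclideanSpace ℝ (Fin 3) → EuclideanSpace ℝ (Fin 3))
    (x₀ : EuclideanSpace ℝ (Fin 3)) (δ d : ℝ) (η : ℝ → ℝ) (t : ℝ) : Prop :=
  ∀ x y : EuclideanSpace ℝ (Fin 3),
    x ∈ ball x₀ (δ * Real.sqrt (ν * (T - t))) → y ∈ ball x₀ (δ * Real.sqrt (ν * (T - t))) →
    d < ‖curl (u t) x‖ → d < ‖curl (u t) y‖ →
      ‖vorticityDirection (curl (u t)) x - vorticityDirection (curl (u t)) y‖ ≤ η ‖x - y‖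

/-- Unfolding `SliceAligned`. [cite: BarkerPrange2020Alignment, Thm. 3 (5.4) (arXiv:1906.08225, p. 18)] -/
theorem sliceAligned_iff {ν T : ℝ} {u : ℝ → EuclideanSpace ℝ (Fin 3) → EuclideanSpace ℝ (Fin 3)}
    {x₀ : EuclideanSpace ℝ (Fin 3)} {δ d : ℝ} {η : ℝ → ℝ} {t : ℝ} :
    SliceAligned ν T u x₀ δ d η t ↔
      ∀ x y : EuclideanSpace ℝ (Fin 3),
        x ∈ ball x₀ (δ * Real.sqrt (ν * (T - t))) → y ∈ ball x₀ (δ * Real.sqrt (ν * (T - t))) →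
        d < ‖curl (u t) x‖ → d < ‖curl (u t) y‖ →
          ‖vorticityDirection (curl (u t)) x - vorticityDirection (curl (u t)) y‖ ≤ η ‖x - y‖ :=
  Iff.rfl

/-- The slice hypothesis is monotone in the threshold: alignment above `d` gives alignment above
any `d' ≥ d` (the printed `Ω_d` shrinks as `d` grows).
[cite: BarkerPrange2020Alignment, Thm. 3 (5.4) (arXiv:1906.08225, p. 18)] -/
theorem SliceAligned.mono_threshold {ν T : ℝ}
    {u : ℝ → EuclideanSpace ℝ (Fin 3) → EuclideanSpace ℝ (Fin 3)} {x₀ : EuclideanSpace ℝ (Fin 3)}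
    {δ d d' : ℝ} {η : ℝ → ℝ} {t : ℝ} (h : SliceAligned ν T u x₀ δ d η t) (hd : d ≤ d') :
    SliceAligned ν T u x₀ δ d' η t :=
  fun x y hx hy hdx hdy => h x y hx hy (hd.trans_lt hdx) (hd.trans_lt hdy)

/-- Giga–Miura's global continuous-alignment hypothesis (CA) at time `t` — the modulus `η` between
ANY two points of `{|ω(·,t)| > d}` — implies Barker–Prange's slice hypothesis at `t` for every
centre `x₀` and every `δ` (restriction to the parabolic ball; p. 18: Theorem 3 "improves the
result obtained in [GM11]"). [cite: BarkerPrange2020Alignment, §5.2 (arXiv:1906.08225, p. 18)] -/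
theorem SliceAligned.of_continuousAlignment {ν T : ℝ}
    {u : ℝ → EuclideanSpace ℝ (Fin 3) → EuclideanSpace ℝ (Fin 3)} {d : ℝ} {η : ℝ → ℝ} {t : ℝ}
    (hCA : ∀ x y : EuclideanSpace ℝ (Fin 3), d < ‖curl (u t) x‖ → d < ‖curl (u t) y‖ →
      ‖vorticityDirection (curl (u t)) x - vorticityDirection (curl (u t)) y‖ ≤ η ‖x - y‖)
    (x₀ : EuclideanSpace ℝ (Fin 3)) (δ : ℝ) : SliceAligned ν T u x₀ δ d η t :=
  fun x y _ _ hdx hdy => hCA x y hdx hdy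

end BarkerPrange2020

/-- **Barker–Prange 2020, Theorem 3 (vorticity bounded, or vorticity direction uniformly
continuous, on concentrating parabolic balls along a sequence of times excludes a Type-I singular
point; whole space).** Let `ν > 0`, `T > 0`, `M` a constant, and let `(u, p)` be a classical
unforced Navier–Stokes solution on `ℝ³ × [0, T)` which is Leray–Hopf on `[0, T)` from a compactly
supported (smooth, divergence-free) datum `u 0` and obeys the **global Type-I bound**
`‖u(t, x)‖ ≤ M/√(T − t)` for all `x` and all `t ∈ (0, T)`. Then there is `δ > 0` (printed:
`δ = δ(M, u₀)`) such that for every centre `x₀` and every sequence of times `t⁽ⁿ⁾ ↑ T` in `(0, T)`: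
(5.3) if the vorticity is bounded on the concentrating balls, `sup_n sup_{|x−x₀|<δ√(ν(T−t⁽ⁿ⁾))}
|ω(x, t⁽ⁿ⁾)| < ∞`, then `(T, x₀)` is a regular point (`u` is essentially bounded on some backward
cylinder `(T − r², T) × B_r(x₀)`, i.e. not a backward singular point); and (5.4) if for some `d > 0`
and some modulus `η` (continuous, `η 0 = 0`) the vorticity direction satisfies
`‖ξ(x,t⁽ⁿ⁾) − ξ(y,t⁽ⁿ⁾)‖ ≤ η(‖x − y‖)` for all `n` and all `x, y` in the ball
`B(x₀, δ√(ν(T − t⁽ⁿ⁾)))` with `|ω(x,t⁽ⁿ⁾)|, |ω(y,t⁽ⁿ⁾)| > d` (`BarkerPrange2020.SliceAligned`), then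
`(T, x₀)` is a regular point. Printed for mild solutions with `u₀ ∈ C₀^∞(ℝ³)` and `ν = 1`; see the
module docstring for the transcription (scaling in `ν`, regular point = `¬ IsBackwardSingularPoint`,
the constant `C` of the printed `Cη` absorbed into `η`).
[cite: BarkerPrange2020Alignment, Thm. 3 ((5.3)–(5.4), arXiv:1906.08225 §5.2 p. 18); p. 3 (regular points)] -/
def barkerPrange2020_alignment_concentrating_typeI : Prop :=
  ∀ (ν T M : ℝ), 0 < ν → 0 < T →
    ∀ (u : ℝ → EuclideanSpace ℝ (Fin 3) → EuclideanSpace ℝ (Fin 3))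
      (p : ℝ → EuclideanSpace ℝ (Fin 3) → ℝ),
      IsClassicalNSSolutionOn (Ico 0 T) ν 0 u p →
      IsLerayHopfOn T ν 0 (u 0) u →
      HasCompactSupport (u 0) →
      (∀ t ∈ Ioo 0 T, ∀ x : EuclideanSpace ℝ (Fin 3), ‖u t x‖ ≤ M / Real.sqrt (T - t)) →
      ∃ δ : ℝ, 0 < δ ∧
        ∀ (x₀ : EuclideanSpace ℝ (Fin 3)) (s : ℕ → ℝ),
          (∀ n, s n ∈ Ioo 0 T) → StrictMono s → Tendsto s atTop (𝓝 T) →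
          ((∃ K : ℝ, ∀ n, ∀ x ∈ ball x₀ (δ * Real.sqrt (ν * (T - s n))), ‖curl (u (s n)) x‖ ≤ K) →
              ¬ IsBackwardSingularPoint u (T, x₀)) ∧
          (∀ (d : ℝ) (η : ℝ → ℝ), 0 < d → Continuous η → η 0 = 0 →
            (∀ n, BarkerPrange2020.SliceAligned ν T u x₀ δ d η (s n)) →
              ¬ IsBackwardSingularPoint u (T, x₀))

namespace barkerPrange2020_alignment_concentrating_typeI

variable {ν T M : ℝ} {u : ℝ → EuclideanSpace ℝ (Fin 3) → EuclideanSpace ℝ (Fin 3)}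
  {p : ℝ → EuclideanSpace ℝ (Fin 3) → ℝ}

/-- From a set of times accumulating at `T > 0` from the left one extracts a strictly increasing
sequence of such times in `(0, T)` converging to `T`. [folklore] -/
private theorem exists_strictMono_seq_of_frequently {T : ℝ} (hT : 0 < T) {P : ℝ → Prop}
    (hP : ∃ᶠ t in 𝓝[<] T, P t) :
    ∃ s : ℕ → ℝ, (∀ n, s n ∈ Ioo 0 T) ∧ StrictMono s ∧ Tendsto s atTop (𝓝 T) ∧ ∀ n, P (s n) := by
  -- beyond every `a < T` there is a time `t ∈ (a, T)` with `P t`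
  have step : ∀ a < T, ∃ t, a < t ∧ t < T ∧ P t := by
    intro a ha
    obtain ⟨t, hPt, ht⟩ := (hP.and_eventually (Ioo_mem_nhdsLT ha)).exists
    exact ⟨t, ht.1, ht.2, hPt⟩
  choose! f hf₁ hf₂ hf₃ using step
  -- barrier sequence `a n = T - T/(n+2) ∈ (0, T)`, `a n → T`
  set a : ℕ → ℝ := fun n => T - T / ((n + 2 : ℕ) : ℝ) with ha_def
  have ha_lt : ∀ n, a n < T := fun n => by
    have : 0 < T / ((n + 2 : ℕ) : ℝ) := by positivity
    simp only [ha_def]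
    linarith
  have ha_pos : ∀ n, 0 < a n := fun n => by
    have : T / ((n + 2 : ℕ) : ℝ) < T :=
      div_lt_self hT (by exact_mod_cast (show 1 < n + 2 by omega))
    simp only [ha_def]
    linarith
  have ha_tend : Tendsto a atTop (𝓝 T) := by
    have h := (tendsto_const_div_atTop_nhds_zero_nat T).comp (tendsto_add_atTop_nat 2)
    have h' : Tendsto (fun n : ℕ => T - T / ((n + 2 : ℕ) : ℝ)) atTop (𝓝 (T - 0)) :=
      tendsto_const_nhds.sub h
    rw [sub_zero] at h'
    exact h'
  -- the recursion `s 0 = f (a 0)`, `s (n+1) = f (max (s n) (a (n+1)))`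
  let s : ℕ → ℝ := fun n => Nat.rec (f (a 0)) (fun k b => f (max b (a (k + 1)))) n
  have hs0 : s 0 = f (a 0) := rfl
  have hsucc : ∀ n, s (n + 1) = f (max (s n) (a (n + 1))) := fun n => rfl
  have hsT : ∀ n, s n < T := by
    intro n
    induction n with
    | zero => rw [hs0]; exact hf₂ _ (ha_lt 0)
    | succ k ih => rw [hsucc]; exact hf₂ _ (max_lt ih (ha_lt _))
  have harg : ∀ n, max (s n) (a (n + 1)) < T := fun n => max_lt (hsT n) (ha_lt _)
  have hsa : ∀ n, a n < s n := by
    intro n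
    cases n with
    | zero => rw [hs0]; exact hf₁ _ (ha_lt 0)
    | succ k => rw [hsucc]; exact lt_of_le_of_lt (le_max_right _ _) (hf₁ _ (harg k))
  have hmono : StrictMono s := strictMono_nat_of_lt_succ fun n => by
    rw [hsucc]
    exact lt_of_le_of_lt (le_max_left _ _) (hf₁ _ (harg n))
  refine ⟨s, fun n => ⟨(ha_pos n).trans (hsa n), hsT n⟩, hmono, ?_, ?_⟩
  · exact tendsto_of_tendsto_of_tendsto_of_le_of_le ha_tend tendsto_const_nhds
      (fun n => (hsa n).le) (fun n => (hsT n).le)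
  · intro n
    cases n with
    | zero => rw [hs0]; exact hf₃ _ (ha_lt 0)
    | succ k => rw [hsucc]; exact hf₃ _ (harg k)

/-- **Theorem 3 (5.4), sequence-free form.** Under the hypotheses of
`barkerPrange2020_alignment_concentrating_typeI` there is `δ > 0` such that if the slice alignment
`BarkerPrange2020.SliceAligned ν T u x₀ δ d η t` holds at a set of times `t` accumulating at `T`
from the left (`∃ᶠ t in 𝓝[<] T`), then `(T, x₀)` is a regular point: a strictly increasing
sequence `t⁽ⁿ⁾ ↑ T` of such times is extracted and the printed theorem applied along it.
[cite: BarkerPrange2020Alignment, Thm. 3 (5.4) (arXiv:1906.08225, p. 18)] -/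
theorem regular_of_frequently (h : barkerPrange2020_alignment_concentrating_typeI)
    (hν : 0 < ν) (hT : 0 < T) (hcl : IsClassicalNSSolutionOn (Ico 0 T) ν 0 u p)
    (hLH : IsLerayHopfOn T ν 0 (u 0) u) (hc : HasCompactSupport (u 0))
    (hI : ∀ t ∈ Ioo 0 T, ∀ x : EuclideanSpace ℝ (Fin 3), ‖u t x‖ ≤ M / Real.sqrt (T - t)) :
    ∃ δ : ℝ, 0 < δ ∧
      ∀ (x₀ : EuclideanSpace ℝ (Fin 3)) (d : ℝ) (η : ℝ → ℝ), 0 < d → Continuous η → η 0 = 0 →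
        (∃ᶠ t in 𝓝[<] T, BarkerPrange2020.SliceAligned ν T u x₀ δ d η t) →
          ¬ IsBackwardSingularPoint u (T, x₀) := by
  obtain ⟨δ, hδ, hmain⟩ := h ν T M hν hT u p hcl hLH hc hI
  refine ⟨δ, hδ, fun x₀ d η hd hη hη0 hfreq => ?_⟩
  obtain ⟨s, hs, hmono, htend, hP⟩ := exists_strictMono_seq_of_frequently hT hfreq
  exact (hmain x₀ s hs hmono htend).2 d η hd hη hη0 hP

/-- **Barker–Prange 2020, Remark 15 (the modulus is broken on the concentrating balls).** Under
the hypotheses of Theorem 3, with its `δ > 0`: if `(T, x₀)` is a (backward) singular point, then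
for every sequence `t⁽ⁿ⁾ ↑ T` in `(0, T)`, every threshold `d > 0` and every modulus `η`
(continuous, `η 0 = 0`), the vorticity direction breaks the modulus `η` on
`{|ω| > d} ∩ {t⁽ⁿ⁾} × B(x₀, δ√(ν(T − t⁽ⁿ⁾)))` for all sufficiently large `n` (otherwise the slice
alignment holds along a subsequence, to which Theorem 3 applies). ("our Theorem above implies a
more precise description of the vorticity direction near the blow-up time. Namely, the modulus of
continuity `η` is broken on the set `{(x, t⁽ⁿ⁾) : |x − x₀| < δ√(T − t⁽ⁿ⁾)} ∩ Ω_d` for all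
sufficiently large `n`.")
[cite: BarkerPrange2020Alignment, Remark 15 (arXiv:1906.08225, p. 18)] -/
theorem eventually_not_sliceAligned (h : barkerPrange2020_alignment_concentrating_typeI)
    (hν : 0 < ν) (hT : 0 < T) (hcl : IsClassicalNSSolutionOn (Ico 0 T) ν 0 u p)
    (hLH : IsLerayHopfOn T ν 0 (u 0) u) (hc : HasCompactSupport (u 0))
    (hI : ∀ t ∈ Ioo 0 T, ∀ x : EuclideanSpace ℝ (Fin 3), ‖u t x‖ ≤ M / Real.sqrt (T - t)) :
    ∃ δ : ℝ, 0 < δ ∧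
      ∀ x₀ : EuclideanSpace ℝ (Fin 3), IsBackwardSingularPoint u (T, x₀) →
        ∀ s : ℕ → ℝ, (∀ n, s n ∈ Ioo 0 T) → StrictMono s → Tendsto s atTop (𝓝 T) →
          ∀ (d : ℝ) (η : ℝ → ℝ), 0 < d → Continuous η → η 0 = 0 →
            ∀ᶠ n in atTop, ¬ BarkerPrange2020.SliceAligned ν T u x₀ δ d η (s n) := by
  obtain ⟨δ, hδ, hmain⟩ := h ν T M hν hT u p hcl hLH hc hI
  refine ⟨δ, hδ, fun x₀ hsing s hs hmono htend d η hd hη hη0 => ?_⟩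
  by_contra hne
  rw [not_eventually] at hne
  simp only [not_not] at hne
  obtain ⟨φ, hφ, hPφ⟩ := extraction_of_frequently_atTop hne
  exact (hmain x₀ (s ∘ φ) (fun n => hs (φ n)) (hmono.comp hφ)
    (htend.comp hφ.tendsto_atTop)).2 d η hd hη hη0 hPφ hsing

/-- **Theorem 3 improves Giga–Miura 2011** (p. 18: "this improves the result obtained in
[GM11]"), at the level of singular points: under the hypotheses of Theorem 3, Giga–Miura's global
continuous-alignment hypothesis (CA) — one modulus `η` for the vorticity direction between any two
points of `Ω_d = {|ω| > d}` at every time `t ∈ (0, T)` — implies the slice hypothesis on every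
concentrating family of balls, so NO point `(T, x₀)` is singular.
[cite: BarkerPrange2020Alignment, Thm. 3 and §5.2 (arXiv:1906.08225, p. 18)] -/
theorem regular_of_continuousAlignment (h : barkerPrange2020_alignment_concentrating_typeI)
    (hν : 0 < ν) (hT : 0 < T) (hcl : IsClassicalNSSolutionOn (Ico 0 T) ν 0 u p)
    (hLH : IsLerayHopfOn T ν 0 (u 0) u) (hc : HasCompactSupport (u 0))
    (hI : ∀ t ∈ Ioo 0 T, ∀ x : EuclideanSpace ℝ (Fin 3), ‖u t x‖ ≤ M / Real.sqrt (T - t))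
    {d : ℝ} {η : ℝ → ℝ} (hd : 0 < d) (hη : Continuous η) (hη0 : η 0 = 0)
    (hCA : ∀ t ∈ Ioo 0 T, ∀ x y : EuclideanSpace ℝ (Fin 3),
      d < ‖curl (u t) x‖ → d < ‖curl (u t) y‖ →
        ‖vorticityDirection (curl (u t)) x - vorticityDirection (curl (u t)) y‖ ≤ η ‖x - y‖)
    (x₀ : EuclideanSpace ℝ (Fin 3)) : ¬ IsBackwardSingularPoint u (T, x₀) := by
  obtain ⟨δ, -, hmain⟩ := regular_of_frequently h hν hT hcl hLH hc hI
  have hev : ∀ᶠ t in 𝓝[<] T, BarkerPrange2020.SliceAligned ν T u x₀ δ d η t := by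
    filter_upwards [Ioo_mem_nhdsLT hT] with t ht
    exact BarkerPrange2020.SliceAligned.of_continuousAlignment (hCA t ht) x₀ δ
  exact hmain x₀ d η hd hη hη0 hev.frequently

end barkerPrange2020_alignment_concentrating_typeI

end Literature.Analysis.FluidPDE

end
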